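import Summits.QuantumFields.YangMills.Theorems.LangevinControlUVOSLegsAtWeakCouplingCStubRopeLimit
import Summits.QuantumFields.YangMills.Theorems.LangevinControlUVOSLegsAtWeakCouplingCStubRopeAnchor
import Summits.QuantumFields.YangMills.Theorems.LangevinControlUVOSLegsAtWeakCouplingCStubRopeRPPos2
import Summits.QuantumFields.YangMills.Theorems.LangevinControlUVOSLegsAtWeakCouplingCStubRopeGrowth
import Summits.QuantumFields.YangMills.Theorems.LangevinControlUVOSLegsAtWeakCouplingCStubRopeAsymptotics
import Summits.QuantumFields.YangMills.Theorems.LangevinControlUVOSLegsAtWeakCouplingCStubRopeHermitian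
import Summits.QuantumFields.YangMills.Theorems.ParabolicTrajectoryLatticeGapOnTrajectoryTransferHankelTorus
import Summits.QuantumFields.YangMills.Theorems.LangevinControlUVOSLegsFromFemtoAndGapDefsR3
import HarnessLib

/-!
# Stub `stub_rope` of line `Sketch` (crux `OSLegsAtWeakCouplingC`, stmt-QuantumFields-16207): the lattice
# reflection-positivity rope — final assembly

Registered stub `stub_rope : Statement.stub_rope` (DefsR3 §4.4): from `a > 0`, `a → 0` and H3 (`GapInUnits`) alone
there are scheme demands `(b₀, g)` and a rate `Δ > 0` such that along EVERY soft bundle meeting them the limit family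
is reflection positive on positive-time off-diagonal tuples (`RPPos`) and its diagonal connected OS form decays at
rate `Δ` on the dense class (`Decay`).

Assembly of the landed / registered pieces:
* the anchor `exists_anchor` (helper file `…StubRopeAnchor`): H3 rate `c₁`, threshold `β₂`, volume demand `S₁g` and
  constants `D n R`; we take `b₀ = β₂`, `Δ = c₁`;
* the growth demand `exists_ropeGrowth` (`…StubRopeGrowth`) fed with `D`: `g β k = max (S₁g β) (growth β k)`;
* `RPPos`: `rpPos_of_softBundle'` (`…StubRopeRPPos2`);
* `Decay` for `t > 0`, arity `n ≥ 1`: on the lattice of step `k` the smeared field `X_k = fieldObs r L_k a_k F m_k`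
  of `F` lives in the time slab `[1, w_k]` (`dependsOn_fieldObs_slab`), the Hankel rope
  `norm_osCorr_timeShift_le_of_decay` with the far bound of the anchor at separation `2^{J_k} m_k` gives
  `‖x_k(m_k)‖ ≤ (V_k^{N_k−1} C_k)^{1/N_k} e^{−c₁ a_k m_k}`; `x_k(m_k) → S₁(ΘF* ⊗ T_tF) − |S₁F|²` and
  `V_k → Re (S₁(ΘF* ⊗ F) − |S₁F|²)` (`tendsto_osCorr_softBundle`), the loss factor disappears
  (`le_of_hankel_tendsto`, growth demand), and hermiticity (`conn_translate_of_rpPos`) identifies the limits with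
  `conn S₁ F (T_tF)` and `conn S₁ F F`; arity `0` and `t = 0` are trivial.
Refs: OsterwalderSeiler1978 §2; GlimmJaffe1987 §6.1, §19.7; FrohlichIsraelLiebSimon1978 §2; OsterwalderSchrader1973 §3.
-/

set_option autoImplicit false

noncomputable section

open scoped SchwartzMap BigOperators ComplexConjugate
open MeasureTheory Filter Topology
open Literature.MathematicalPhysics.QuantumFieldTheory Literature.MathematicalPhysics.QuantumLattice
open Literature.MathematicalPhysics.AQFT
open Literature.Probability.LatticeModels (box Site mem_box)
open Summit.QuantumFields.YangMills.Theorems.OSLegsFromFemtoAndGap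
open Summit.QuantumFields.YangMills.Theorems.OSLegsAtWeakCouplingC
open Summit.QuantumFields.YangMills.Cruxes.LatticeGapOnTrajectory.OrbitKantorovichFiniteSize.Transfer
  (Hankel.norm_osCorr_timeShift_le_of_decay Hankel.osVar_timeReflect_nonneg Hankel.torusTimeShift_one_iterate)

namespace Summit.QuantumFields.YangMills.Cruxes.OSLegsFromFemtoAndGap.DlrCollarTransfer

/-- `x² d e ≤ (1 + x)² d e` for non-negative reals. -/
theorem rope_sq_mul_mul_le {x d e : ℝ} (hx : 0 ≤ x) (hd : 0 ≤ d) (he : 0 ≤ e) :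
    x ^ 2 * d * e ≤ (1 + x) ^ 2 * d * e :=
  mul_le_mul_of_nonneg_right (mul_le_mul_of_nonneg_right (by nlinarith) hd) he

/-- The torus time shift by `0` is the identity. -/
theorem rope_coe_torusTimeShift_zero {G : Type} [Group G] [MeasurableSpace G] (Sd : ℕ) :
    ⇑(torusTimeShift (G := G) Sd 0) = id := by
  rw [← Hankel.torusTimeShift_one_iterate (G := G) 0, Function.iterate_zero]

/-- **The lattice reflection-positivity rope** (registered stub `stub_rope` of line `Sketch`, DefsR3 §4.4): scheme
demands `(b₀, g)` and a rate `Δ > 0` from `a > 0`, `a → 0` and H3 such that every soft bundle meeting them has a limit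
family with `RPPos` and `Decay Δ`. -/
theorem stub_rope : Statement.stub_rope := by
  intro G _ _ _ _ _ _ r a hapos ha0 hgap
  obtain ⟨c₁, β₂, S₁g, D, hc₁, hDm, hD1, hanchor⟩ := exists_anchor r hgap
  obtain ⟨growth, hgrowth⟩ := exists_ropeGrowth hapos D hDm hD1
  refine ⟨β₂, fun β k => max (S₁g β) (growth β k), c₁, hc₁, fun sch S₁ Tq K hB => ?_⟩
  have hRP : RPPos S₁ := rpPos_of_softBundle' hapos ha0 hB
  refine ⟨hRP, fun n F hFo hFp hFc _ t ht => ?_⟩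
  obtain ⟨⟨h1, -, -, -, -, -, -, h8, h9, -, -, -, -, -, -, -, h17, -, -, -, -⟩, h22⟩ := id hB
  -- arity `0`: both connected forms vanish
  rcases Nat.eq_zero_or_pos n with hn | hn
  · subst hn
    rw [RopeGrowth.conn_arity_zero S₁ h9, RopeGrowth.conn_arity_zero S₁ h9, Complex.zero_re, zero_mul]
  -- `t = 0`: trivial
  rcases ht.eq_or_lt with rfl | ht'
  · rw [RopeGrowth.translateMulti_single_zero, mul_zero, neg_zero, Real.exp_zero, mul_one]
  -- `t > 0`, `n ≥ 1`: the rope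
  -- the support radius and the time support
  obtain ⟨ρ, hρ0, hρ⟩ := hFc.isCompact.isBounded.subset_closedBall_lt 0 0
  have hFT : ∀ u : Fin n → EuclideanSpace ℝ (Fin 4), (∃ l, u l 0 ≤ 0 ∨ ρ < u l 0) → F u = 0 := by
    intro u hu
    by_contra hne
    have hmem := subset_tsupport _ hne
    obtain ⟨l, hl | hl⟩ := hu
    · exact absurd (hFp hmem l) (not_lt.2 hl)
    · have h1 : ‖u‖ ≤ ρ := mem_closedBall_zero_iff.1 (hρ hmem)
      have h2 : u l 0 ≤ ‖u‖ :=
        ((le_abs_self _).trans (by simpa using PiLp.norm_apply_le (u l) 0)).trans (norm_le_pi_norm u l)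
      linarith
  -- the dyadic steps
  obtain ⟨m, hm⟩ : ∃ m : ℕ → ℕ, ∀ k, m k = ⌊t / sch.a k⌋₊ := ⟨_, fun _ => rfl⟩
  obtain ⟨w, hw⟩ : ∃ w : ℕ → ℕ, ∀ k, w k = ⌈ρ / sch.a k⌉₊ + 1 := ⟨_, fun _ => rfl⟩
  obtain ⟨J, hJ⟩ : ∃ J : ℕ → ℕ, ∀ k, J k = Nat.log 2 ((sch.L k - 2 * w k) / m k) := ⟨_, fun _ => rfl⟩
  obtain ⟨hev, hmt, hNtop, hloss⟩ := hgrowth sch.β sch.a sch.L h1 (fun k => (le_max_right _ _).trans (h22 k).2)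
    sch.tendsto_a n ρ hρ0.le t ht' m w J hm hw hJ
  have hb : ∀ᶠ k in atTop, 1 ≤ sch.L k ∧ 2 ^ J k * m k + w k ≤ sch.L k ∧ w k + 2 ^ J k * m k ≤ sch.L k ∧
      w k ≤ 2 * sch.L k ∧ ⌈ρ / sch.a k⌉₊ + 2 + m k ≤ sch.L k + 1 ∧ ⌈ρ / sch.a k⌉₊ + 2 + 0 ≤ sch.L k + 1 := by
    filter_upwards [hev] with k hk
    obtain ⟨hk1, hk2, hk3⟩ := hk
    have := hw k
    omega
  -- lattice support of `F` at scale `a_k`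
  have hsupp : ∀ k (y : Fin n → Site 4), F (fun l => sch.a k • siteToE (y l)) ≠ 0 → ∀ l,
      y l ∈ box 4 (w k) ∧ 1 ≤ y l 0 ∧ y l 0 + 1 ≤ (w k : ℤ) := fun k y hy l => by
    rw [hw k]; exact RopeGrowth.lattice_support hFp hρ (sch.a_pos k) hy l
  have hvan : ∀ k (y : Fin n → Site 4), (∃ l, y l 0 ≤ 0) → F (fun l => sch.a k • siteToE (y l)) = 0 :=
    fun k y ⟨l, hl⟩ => apply_eq_zero_of_time (sch.a_pos k) F hFT y ⟨l, Or.inl hl⟩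
  -- the lattice objects
  set mk : ℕ → Fin 4 × Fin 4 → ℝ := fun k pl =>
    wilsonTorusMean r.ρ (sch.β k) (sch.L k) (fun U => plaquetteObs r.ρ 0 pl.1 pl.2 U) with hmk
  set S : ℕ → ℝ := fun k => ∑ _q ∈ Fintype.piFinset (fun _ : Fin n => Finset.univ.filter fun pl : Fin 4 × Fin 4 => pl.1 < pl.2),
    ∑ y ∈ Fintype.piFinset (fun _ : Fin n => box 4 (w k)), ‖F (fun l => sch.a k • siteToE (y l))‖ with hS
  set C : ℕ → ℝ := fun k => (1 + S k) ^ 2 * D n (w k) with hC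
  set V : ℕ → ℝ := fun k => osVar (wilsonMeasure (d := 4) (L := 2 * sch.L k + 1) r.ρ (sch.β k))
    GaugeConfig.timeReflect (fieldObs r (sch.L k) (sch.a k) F (mk k)) with hV
  have hS0 : ∀ k, 0 ≤ S k := fun k => Finset.sum_nonneg fun _ _ => Finset.sum_nonneg fun _ _ => norm_nonneg _
  have hC1 : ∀ k, 1 ≤ C k := fun k =>
    one_le_mul_of_one_le_of_one_le (one_le_pow₀ (by linarith [hS0 k])) (hD1 n _)
  -- (a) the limits of the shifted autocorrelation and of the OS variance
  have hx := tendsto_osCorr_softBundle hapos ha0 hB hn F hFp hFo hFT m hmt (hb.mono fun k hk => hk.2.2.2.2.1)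
  have hV0 : ∀ k, 0 ≤ V k := fun k =>
    Hankel.osVar_timeReflect_nonneg r.ρ r.continuous (h17 k).1 (le_trans (by norm_num) (h17 k).2.2.1)
      (measurable_fieldObs r _ _ F _) (exists_norm_fieldObs_le r _ _ F _)
      (dependsOn_fieldObs r (le_trans (by norm_num) (h17 k).2.2.1) _ F (hvan k) _)
  have hVt : Tendsto V atTop (𝓝 (S₁ (n + n) ((osAdjoint F).appendTensor
      (translateMulti (EuclideanSpace.single 0 (0 : ℝ)) F)) - conj (S₁ n F) * S₁ n F).re) := by
    have h := tendsto_osCorr_softBundle hapos ha0 hB hn F hFp hFo hFT (fun _ => 0) (t := 0)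
      (by simp) (hb.mono fun k hk => hk.2.2.2.2.2)
    refine ((Complex.continuous_re.tendsto _).comp h).congr fun k => ?_
    simp only [Function.comp_apply, hV, osVar, rope_coe_torusTimeShift_zero]
    rfl
  -- (b) the Hankel bound, eventually
  have hle : ∀ᶠ k in atTop, ‖osCorr (wilsonMeasure (d := 4) (L := 2 * sch.L k + 1) r.ρ (sch.β k))
      GaugeConfig.timeReflect (⇑(torusTimeShift (2 * sch.L k + 1) (m k)))
      (fieldObs r (sch.L k) (sch.a k) F (mk k)) (fieldObs r (sch.L k) (sch.a k) F (mk k))‖ ≤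
      (V k ^ (2 ^ J k - 1) * C k) ^ (((2 ^ J k : ℕ) : ℝ)⁻¹) * Real.exp (-(c₁ * (sch.a k * m k))) := by
    filter_upwards [hb] with k hk
    obtain ⟨hL1, hJm, hRM, hw2, -, -⟩ := hk
    -- the far bound of the anchor at separation `2^J m`
    have hfar := hanchor (sch.β k) (h22 k).1 (sch.L k) ((le_max_left _ _).trans (h22 k).2) (2 ^ J k * m k) (w k)
      hRM (sch.a k) F (fun y hy l => ⟨(hsupp k y hy l).1, (hsupp k y hy l).2.1⟩)
    have hfar' : ‖osCorr (wilsonMeasure (d := 4) (L := 2 * sch.L k + 1) r.ρ (sch.β k)) GaugeConfig.timeReflect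
        (⇑(torusTimeShift (2 * sch.L k + 1) (2 ^ J k * m k)))
        (fieldObs r (sch.L k) (sch.a k) F (mk k)) (fieldObs r (sch.L k) (sch.a k) F (mk k))‖ ≤
        C k * Real.exp (-(c₁ * sch.a k * (2 ^ J k * m k))) := by
      refine hfar.trans ?_
      have he : c₁ * a (sch.β k) * ((2 ^ J k * m k : ℕ) : ℝ) = c₁ * sch.a k * (2 ^ J k * m k) := by
        rw [h1 k]; push_cast; ring
      rw [he]
      exact rope_sq_mul_mul_le (hS0 k) (zero_le_one.trans (hD1 n _)) (Real.exp_nonneg _)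
    have h := Hankel.norm_osCorr_timeShift_le_of_decay r.ρ r.continuous (h17 k).1 hL1
      (measurable_fieldObs r _ _ F _) (exists_norm_fieldObs_le r _ _ F _)
      (RopeRP.dependsOn_fieldObs_slab r hw2 _ F (fun y hy l => (hsupp k y hy l).2) _) hJm hfar'
    refine h.trans_eq ?_
    congr 2
    · push_cast; rfl
    · ring
  -- (c) pass to the limit
  have hexp : Tendsto (fun k => Real.exp (-(c₁ * (sch.a k * m k)))) atTop (𝓝 (Real.exp (-(c₁ * t)))) :=
    (Real.continuous_exp.tendsto _).comp ((hmt.const_mul c₁).neg)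
  have key := le_of_hankel_tendsto hle ((continuous_norm.tendsto _).comp hx) hV0 hVt hNtop
    (fun k => zero_lt_one.trans_le (hC1 k))
    (hloss _ (apply_nonneg _ _) S hS0 fun k => RopeGrowth.sum_norm_apply_le F (sch.a k) (w k)) hexp
  -- (d) identification through hermiticity
  rw [RopeGrowth.translateMulti_single_zero] at key
  have hct := RopeGrowth.conn_translate_of_rpPos S₁ h9 h8 hRP hFp hFo (EuclideanSpace.single 0 t)
  have hc0 := RopeGrowth.conn_translate_of_rpPos S₁ h9 h8 hRP hFp hFo (EuclideanSpace.single 0 (0 : ℝ))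
  rw [RopeGrowth.translateMulti_single_zero] at hc0
  rw [← hct, ← hc0] at key
  exact (Complex.re_le_norm _).trans key

end Summit.QuantumFields.YangMills.Cruxes.OSLegsFromFemtoAndGap.DlrCollarTransfer

end
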